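import Summits.CriticalPhenomena.PercolationContinuityZ3.Theorems.PercNearOneGluingNoHeavyLowerTailSahiGridPatternOrthant

/-!
# `NoHeavyLowerTail` (crux stmt-CriticalPhenomena-4575), Sahi programme P1: **THE HARRIS-SHARPENED LIFTS** — the two orthant lifts
# hold for the sharper functional `G(U;B,C) = sStarD U B C − H(U, B∩C)` (pattern functional minus the Harris slack of `U` against `B∩C`)

Support file (Sahi cell, seat `prim-sahi-p1`, generation 18; `--supports stmt-CriticalPhenomena-4575`).  Pure proofs, NO definitions,
no `sorry`, standard axioms.  Vocabulary of `…SahiGridPattern{,Harris,Kleitman,TwoLayerTop,TopOnlyTop,Orthant}`.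
For `U, B, C ⊆ [3]^m`: `S = sStarD U B C = 2·2^m·#(UBC) − N(U;BC) − N(B;UC) − N(C;UB) + M` (counting form), `H(U, B∩C) =
2^m·#(U∩B∩C) − N(U; B∩C) ≥ 0` the coefficientwise Harris slack, and `G(U;B,C) := S − H(U,B∩C) = 2^m·#(UBC) − N(B;UC) − N(C;UB) + M`.
THIS FILE: the two instance-blind lifts of the orthant theorem (`sum_sStarD_le_of_liftTwo`, `two_mul_sStarD_top_le_of_topOnly`) hold
VERBATIM for `G` (slices along the last axis): **`liftTwo_harris`** (`A = D × {1,2}`: `Σ_{j,k∈{1,2}} G(D;B_j,C_k) ≤ G(A;B,C)`, difference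
`= 2^n·#(D∩(B₂∖B₁)∩(C₂∖C₁)) +` four fibre-Kleitman slacks `+ L(D;B₂∖B₁,C₂∖C₁)` — the `S`-lift minus its two Harris-type parts, so the
`G`-lift is the SHARPER statement) and **`topOnly_harris`** (`A = D × {2}`: `2·G(D;B₂,C₂) ≤ G(A;B,C)`, difference = four fibre-Kleitman
slacks `+ L(D;B₂∖B₀,C₂∖C₁) + L(D;B₂∖B₁,C₂∖C₀)`).  The companion file `…OrthantHarris` runs the orthant induction with `G` and proves
`sStarD (↑p) B C ≥ H(↑p, B∩C)` for every principal up-set in every dimension (generation 16's CONJECTURE P).  Statements are in the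
indicator-sum language of `sStarD_counting` (`Σ_{p,q} 1_X(p)1_Y(q)1_Z(q)[p δ̸ q] = N(X;Y∩Z)`, `Σ_p 1_X1_Y1_Z = #(X∩Y∩Z)`). [this work]
-/

namespace Summit.CriticalPhenomena.PercolationContinuityZ3.Theorems.SahiGridPattern

open Finset SahiGrid3
open scoped BigOperators

variable {n : ℕ}

/-! ### Slicing the two Harris-slack ingredients along the last axis -/

/-- `[snoc p i δ̸ snoc q j] = [p δ̸ q]·[i ≠ j]`. [this work] -/
theorem ite_totDist_snoc (p q : Pd n) (i j : Fin 3) :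
    (if TotDist (Fin.snoc p i : Pd (n + 1)) (Fin.snoc q j) = true then (1 : ℤ) else 0) =
      (if TotDist p q = true then (1 : ℤ) else 0) * (if i ≠ j then 1 else 0) := by
  by_cases h1 : TotDist p q = true
  · by_cases h2 : i ≠ j
    · rw [if_pos ((totDist_snoc_iff p q i j).2 ⟨h1, h2⟩), if_pos h1, if_pos h2]; ring
    · rw [if_neg (fun h => h2 ((totDist_snoc_iff p q i j).1 h).2), if_pos h1, if_neg h2]; ring
  · rw [if_neg (fun h => h1 ((totDist_snoc_iff p q i j).1 h).1), if_neg h1]; ring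

/-- Slicing the diagonal count `Σ_x 1_A 1_B 1_C` along the last axis. [this work] -/
theorem diag3_snoc (A B C : Finset (Pd (n + 1))) :
    (∑ x : Pd (n + 1), ind A x * ind B x * ind C x) =
      ∑ i : Fin 3, ∑ p : Pd n, ind A (Fin.snoc p i) * ind B (Fin.snoc p i) * ind C (Fin.snoc p i) :=
  sum_snoc _

/-- Slicing the pair count `T(A;B,C) = Σ_{x,y} 1_A(x)1_B(y)1_C(y)[x δ̸ y]` along the last axis: level blocks `(i,j)` with `i ≠ j`. [this work] -/
theorem td3_snoc (A B C : Finset (Pd (n + 1))) :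
    (∑ x : Pd (n + 1), ∑ y : Pd (n + 1), ind A x * ind B y * ind C y * (if TotDist x y = true then (1 : ℤ) else 0)) =
      ∑ i : Fin 3, ∑ j : Fin 3, (if i ≠ j then (1 : ℤ) else 0) *
        ∑ p : Pd n, ∑ q : Pd n, ind A (Fin.snoc p i) * ind B (Fin.snoc q j) * ind C (Fin.snoc q j) *
          (if TotDist p q = true then (1 : ℤ) else 0) := by
  rw [sum_snoc (fun x : Pd (n + 1) => ∑ y : Pd (n + 1), ind A x * ind B y * ind C y * (if TotDist x y = true then (1 : ℤ) else 0))]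
  refine Finset.sum_congr rfl fun i _ => ?_
  have inner : ∀ p : Pd n, (∑ y : Pd (n + 1), ind A (Fin.snoc p i) * ind B y * ind C y *
      (if TotDist (Fin.snoc p i : Pd (n + 1)) y = true then (1 : ℤ) else 0)) =
      ∑ j : Fin 3, ∑ q : Pd n, (if i ≠ j then (1 : ℤ) else 0) *
        (ind A (Fin.snoc p i) * ind B (Fin.snoc q j) * ind C (Fin.snoc q j) * (if TotDist p q = true then (1 : ℤ) else 0)) := by
    intro p
    rw [sum_snoc (fun y : Pd (n + 1) => ind A (Fin.snoc p i) * ind B y * ind C y *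
      (if TotDist (Fin.snoc p i : Pd (n + 1)) y = true then (1 : ℤ) else 0))]
    refine Finset.sum_congr rfl fun j _ => Finset.sum_congr rfl fun q _ => ?_
    rw [ite_totDist_snoc]; ring
  rw [Finset.sum_congr rfl fun p _ => inner p, Finset.sum_comm]
  refine Finset.sum_congr rfl fun j _ => ?_
  rw [Finset.mul_sum]
  refine Finset.sum_congr rfl fun p _ => ?_
  rw [Finset.mul_sum]

/-- The nine values `[i ≠ j]` on `Fin 3` (bookkeeping). [this work] -/
theorem ne_vals3 :
    (if (0:Fin 3) ≠ 0 then (1:ℤ) else 0) = 0 ∧ (if (0:Fin 3) ≠ 1 then (1:ℤ) else 0) = 1 ∧ (if (0:Fin 3) ≠ 2 then (1:ℤ) else 0) = 1 ∧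
    (if (1:Fin 3) ≠ 0 then (1:ℤ) else 0) = 1 ∧ (if (1:Fin 3) ≠ 1 then (1:ℤ) else 0) = 0 ∧ (if (1:Fin 3) ≠ 2 then (1:ℤ) else 0) = 1 ∧
    (if (2:Fin 3) ≠ 0 then (1:ℤ) else 0) = 1 ∧ (if (2:Fin 3) ≠ 1 then (1:ℤ) else 0) = 1 ∧ (if (2:Fin 3) ≠ 2 then (1:ℤ) else 0) = 0 := by
  decide

/-! ### The two-level lift for `G` -/

/-- **TWO-LEVEL LIFT, HARRIS-SHARPENED** (every `n`): if the up-set `A ⊆ [3]^{n+1}` misses the bottom level of the last axis and its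
middle and top slices coincide (`A = D × {1,2}`), then for ARBITRARY up-sets `B, C ⊆ [3]^{n+1}`, with `G(X;Y,Z) = sStarD X Y Z +
T(X;Y,Z) − 2^m Σ 1_X1_Y1_Z` (`= sStarD − H(X, Y∩Z)`):  `Σ_{j,k∈{1,2}} G(D;B_j,C_k) ≤ G(A;B,C)`. [this work] -/
theorem liftTwo_harris (A B C : Finset (Pd (n + 1)))
    (hA : IsUpperSet (A : Set (Pd (n + 1)))) (hB : IsUpperSet (B : Set (Pd (n + 1)))) (hC : IsUpperSet (C : Set (Pd (n + 1))))
    (hA0 : ∀ q : Pd n, (Fin.snoc q 0 : Pd (n + 1)) ∉ A)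
    (hA12 : ∀ q : Pd n, (Fin.snoc q 1 : Pd (n + 1)) ∈ A ↔ (Fin.snoc q 2 : Pd (n + 1)) ∈ A) :
    (∑ j ∈ ({1, 2} : Finset (Fin 3)), ∑ k ∈ ({1, 2} : Finset (Fin 3)),
      (sStarD (univ.filter fun q : Pd n => (Fin.snoc q 2 : Pd (n + 1)) ∈ A) (univ.filter fun q : Pd n => (Fin.snoc q j : Pd (n + 1)) ∈ B)
          (univ.filter fun q : Pd n => (Fin.snoc q k : Pd (n + 1)) ∈ C)
        + (∑ p : Pd n, ∑ q : Pd n, ind (univ.filter fun q : Pd n => (Fin.snoc q 2 : Pd (n + 1)) ∈ A) p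
            * ind (univ.filter fun q : Pd n => (Fin.snoc q j : Pd (n + 1)) ∈ B) q
            * ind (univ.filter fun q : Pd n => (Fin.snoc q k : Pd (n + 1)) ∈ C) q * (if TotDist p q = true then (1:ℤ) else 0))
        - 2 ^ n * (∑ p : Pd n, ind (univ.filter fun q : Pd n => (Fin.snoc q 2 : Pd (n + 1)) ∈ A) p
            * ind (univ.filter fun q : Pd n => (Fin.snoc q j : Pd (n + 1)) ∈ B) p
            * ind (univ.filter fun q : Pd n => (Fin.snoc q k : Pd (n + 1)) ∈ C) p)))
      ≤ sStarD A B C + (∑ x, ∑ y, ind A x * ind B y * ind C y * (if TotDist x y = true then (1:ℤ) else 0))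
          - 2 * 2 ^ n * (∑ x, ind A x * ind B x * ind C x) := by
  have h12ne : (1 : Fin 3) ≠ 2 := by decide
  simp only [Finset.sum_pair h12ne]
  set D : Finset (Pd n) := univ.filter fun q : Pd n => (Fin.snoc q 2 : Pd (n + 1)) ∈ A with hDdef
  set P0 : Finset (Pd n) := univ.filter fun q : Pd n => (Fin.snoc q 0 : Pd (n + 1)) ∈ B with hP0def
  set P1 : Finset (Pd n) := univ.filter fun q : Pd n => (Fin.snoc q 1 : Pd (n + 1)) ∈ B with hP1def
  set P2 : Finset (Pd n) := univ.filter fun q : Pd n => (Fin.snoc q 2 : Pd (n + 1)) ∈ B with hP2def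
  set Q0 : Finset (Pd n) := univ.filter fun q : Pd n => (Fin.snoc q 0 : Pd (n + 1)) ∈ C with hQ0def
  set Q1 : Finset (Pd n) := univ.filter fun q : Pd n => (Fin.snoc q 1 : Pd (n + 1)) ∈ C with hQ1def
  set Q2 : Finset (Pd n) := univ.filter fun q : Pd n => (Fin.snoc q 2 : Pd (n + 1)) ∈ C with hQ2def
  have iD2 : ∀ p, ind A (Fin.snoc p 2) = ind D p := fun p => by rw [hDdef, ind_filter_snoc]
  have iD1 : ∀ p, ind A (Fin.snoc p 1) = ind D p := fun p => by
    rw [← iD2 p]; unfold ind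
    by_cases h : (Fin.snoc p 1 : Pd (n + 1)) ∈ A
    · rw [if_pos h, if_pos ((hA12 p).1 h)]
    · rw [if_neg h, if_neg (fun h2 => h ((hA12 p).2 h2))]
  have iA0 : ∀ p, ind A (Fin.snoc p 0) = 0 := fun p => by unfold ind; rw [if_neg (hA0 p)]
  have iP0 : ∀ p, ind B (Fin.snoc p 0) = ind P0 p := fun p => by rw [hP0def, ind_filter_snoc]
  have iP1 : ∀ p, ind B (Fin.snoc p 1) = ind P1 p := fun p => by rw [hP1def, ind_filter_snoc]
  have iP2 : ∀ p, ind B (Fin.snoc p 2) = ind P2 p := fun p => by rw [hP2def, ind_filter_snoc]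
  have iQ0 : ∀ p, ind C (Fin.snoc p 0) = ind Q0 p := fun p => by rw [hQ0def, ind_filter_snoc]
  have iQ1 : ∀ p, ind C (Fin.snoc p 1) = ind Q1 p := fun p => by rw [hQ1def, ind_filter_snoc]
  have iQ2 : ∀ p, ind C (Fin.snoc p 2) = ind Q2 p := fun p => by rw [hQ2def, ind_filter_snoc]
  have hDup : IsUpperSet (D : Set (Pd n)) := by rw [hDdef]; exact isUpperSet_filter_snoc hA 2
  have hP1up : IsUpperSet (P1 : Set (Pd n)) := by rw [hP1def]; exact isUpperSet_filter_snoc hB 1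
  have hP2up : IsUpperSet (P2 : Set (Pd n)) := by rw [hP2def]; exact isUpperSet_filter_snoc hB 2
  have hQ1up : IsUpperSet (Q1 : Set (Pd n)) := by rw [hQ1def]; exact isUpperSet_filter_snoc hC 1
  have hQ2up : IsUpperSet (Q2 : Set (Pd n)) := by rw [hQ2def]; exact isUpperSet_filter_snoc hC 2
  have nP01 : ∀ p, ind P0 p ≤ ind P1 p := fun p => by rw [← iP0, ← iP1]; exact ind_snoc_mono hB p (by decide)
  have nP02 : ∀ p, ind P0 p ≤ ind P2 p := fun p => by rw [← iP0, ← iP2]; exact ind_snoc_mono hB p (by decide)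
  have nP12 : ∀ p, ind P1 p ≤ ind P2 p := fun p => by rw [← iP1, ← iP2]; exact ind_snoc_mono hB p (by decide)
  have nQ01 : ∀ p, ind Q0 p ≤ ind Q1 p := fun p => by rw [← iQ0, ← iQ1]; exact ind_snoc_mono hC p (by decide)
  have nQ02 : ∀ p, ind Q0 p ≤ ind Q2 p := fun p => by rw [← iQ0, ← iQ2]; exact ind_snoc_mono hC p (by decide)
  have nQ12 : ∀ p, ind Q1 p ≤ ind Q2 p := fun p => by rw [← iQ1, ← iQ2]; exact ind_snoc_mono hC p (by decide)
  have sP01 : P0 ⊆ P1 := subset_of_ind_le nP01; have sP02 : P0 ⊆ P2 := subset_of_ind_le nP02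
  have sQ01 : Q0 ⊆ Q1 := subset_of_ind_le nQ01; have sQ02 : Q0 ⊆ Q2 := subset_of_ind_le nQ02
  -- the value of sStarD A B C: eighteen level blocks (as in `sum_sStarD_le_of_liftTwo`)
  have eA : sStarD A B C =
        4 * 2 ^ n * (∑ p, ind D p * ind P1 p * ind Q1 p) + 4 * 2 ^ n * (∑ p, ind D p * ind P2 p * ind Q2 p)
      - 2 * (∑ p, ∑ q, ind D p * ind P0 q * ind Q0 q * (if TotDist p q = true then (1:ℤ) else 0))
      - (∑ p, ∑ q, ind D p * ind P1 q * ind Q1 q * (if TotDist p q = true then (1:ℤ) else 0))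
      - (∑ p, ∑ q, ind D p * ind P2 q * ind Q2 q * (if TotDist p q = true then (1:ℤ) else 0))
      - (∑ p, ∑ q, ind P0 p * ind D q * ind Q1 q * (if TotDist p q = true then (1:ℤ) else 0))
      - (∑ p, ∑ q, ind P2 p * ind D q * ind Q1 q * (if TotDist p q = true then (1:ℤ) else 0))
      - (∑ p, ∑ q, ind P0 p * ind D q * ind Q2 q * (if TotDist p q = true then (1:ℤ) else 0))
      - (∑ p, ∑ q, ind P1 p * ind D q * ind Q2 q * (if TotDist p q = true then (1:ℤ) else 0))
      - (∑ p, ∑ q, ind Q0 p * ind D q * ind P1 q * (if TotDist p q = true then (1:ℤ) else 0))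
      - (∑ p, ∑ q, ind Q2 p * ind D q * ind P1 q * (if TotDist p q = true then (1:ℤ) else 0))
      - (∑ p, ∑ q, ind Q0 p * ind D q * ind P2 q * (if TotDist p q = true then (1:ℤ) else 0))
      - (∑ p, ∑ q, ind Q1 p * ind D q * ind P2 q * (if TotDist p q = true then (1:ℤ) else 0))
      + (∑ q, ∑ r, ind P0 q * ind Q2 r * ind D (thirdPt q r) * (if TotDist q r = true then (1:ℤ) else 0))
      + (∑ q, ∑ r, ind P2 q * ind Q0 r * ind D (thirdPt q r) * (if TotDist q r = true then (1:ℤ) else 0))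
      + (∑ q, ∑ r, ind P0 q * ind Q1 r * ind D (thirdPt q r) * (if TotDist q r = true then (1:ℤ) else 0))
      + (∑ q, ∑ r, ind P1 q * ind Q0 r * ind D (thirdPt q r) * (if TotDist q r = true then (1:ℤ) else 0)) := by
    rw [sStarD_eq_sum_ind]
    simp only [sum_snoc, Fin.sum_univ_three, iA0, iD1, iD2, iP0, iP1, iP2, iQ0, iQ1, iQ2, zero_mul,
      Finset.sum_const_zero, zero_add, Finset.sum_add_distrib]
    rw [block_eq, block_eq, block_eq, block_eq, block_eq, block_eq, block_eq, block_eq, block_eq,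
      block_eq, block_eq, block_eq, block_eq, block_eq, block_eq, block_eq, block_eq, block_eq]
    obtain ⟨h0, h1, h2, h3, h4, h5, h6, h7, h8, h9, h10, h11, h12, h13, h14, h15, h16, h17, h18, h19, h20, h21, h22, h23, h24,
      h25, h26, h27, h28, h29, h30, h31, h32, h33, h34, h35, h36, h37, h38, h39, h40, h41, h42, h43, h44, h45, h46, h47, h48,
      h49, h50, h51, h52, h53, h54, h55, h56, h57, h58, h59⟩ := c_vals_liftTwo
    simp only [h0, h1, h2, h3, h4, h5, h6, h7, h8, h9, h10, h11, h12, h13, h14, h15, h16, h17, h18, h19, h20, h21, h22, h23, h24,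
      h25, h26, h27, h28, h29, h30, h31, h32, h33, h34, h35, h36, h37, h38, h39, h40, h41, h42, h43, h44, h45, h46, h47, h48,
      h49, h50, h51, h52, h53, h54, h55, h56, h57, h58, h59]
    ring
  obtain ⟨m00, m01, m02, m10, m11, m12, m20, m21, m22⟩ := ne_vals3
  have eHT : (∑ x, ∑ y, ind A x * ind B y * ind C y * (if TotDist x y = true then (1:ℤ) else 0)) =
      2 * (∑ p, ∑ q, ind D p * ind P0 q * ind Q0 q * (if TotDist p q = true then (1:ℤ) else 0))
      + (∑ p, ∑ q, ind D p * ind P1 q * ind Q1 q * (if TotDist p q = true then (1:ℤ) else 0))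
      + (∑ p, ∑ q, ind D p * ind P2 q * ind Q2 q * (if TotDist p q = true then (1:ℤ) else 0)) := by
    rw [td3_snoc]
    simp only [Fin.sum_univ_three, iA0, iD1, iD2, iP0, iP1, iP2, iQ0, iQ1, iQ2, zero_mul, Finset.sum_const_zero, mul_zero,
      m00, m01, m02, m10, m11, m12, m20, m21, m22, one_mul, zero_add, add_zero]
    ring
  have eHD : (∑ x, ind A x * ind B x * ind C x) = (∑ p, ind D p * ind P1 p * ind Q1 p) + (∑ p, ind D p * ind P2 p * ind Q2 p) := by
    rw [diag3_snoc]
    simp only [Fin.sum_univ_three, iA0, iD1, iD2, iP1, iP2, iQ1, iQ2, zero_mul, Finset.sum_const_zero, zero_add]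
  have eT11 := sStarD_counting D P1 Q1; have eT12 := sStarD_counting D P1 Q2
  have eT21 := sStarD_counting D P2 Q1; have eT22 := sStarD_counting D P2 Q2
  have K1 := sum_ind_lat_le_td (P1 \ P0) hQ1up hDup
  rw [sum2_ind_sdiff_first sP01, sum2_ind_sdiff_first sP01] at K1
  have K3 := sum_ind_lat_le_td (P2 \ P0) hQ2up hDup
  rw [sum2_ind_sdiff_first sP02, sum2_ind_sdiff_first sP02] at K3
  have swapL : ∀ X Y : Finset (Pd n),
      (∑ p, ∑ q, ind Y p * ind X q * ind D (thirdPt p q) * (if TotDist p q = true then (1:ℤ) else 0)) =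
      ∑ q, ∑ r, ind X q * ind Y r * ind D (thirdPt q r) * (if TotDist q r = true then (1:ℤ) else 0) := by
    intro X Y
    rw [Finset.sum_comm]
    refine Finset.sum_congr rfl fun q _ => Finset.sum_congr rfl fun r _ => ?_
    rw [thirdPt_comm r q, totDist_symm r q]; ring
  have K2 := sum_ind_lat_le_td (Q1 \ Q0) hP1up hDup
  rw [sum2_ind_sdiff_first sQ01, sum2_ind_sdiff_first sQ01] at K2
  have K4 := sum_ind_lat_le_td (Q2 \ Q0) hP2up hDup
  rw [sum2_ind_sdiff_first sQ02, sum2_ind_sdiff_first sQ02] at K4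
  have sw11 := swapL P1 Q1; have sw10 := swapL P1 Q0; have sw22 := swapL P2 Q2; have sw20 := swapL P2 Q0
  have reord : ∀ X Y : Finset (Pd n),
      (∑ p, ∑ q, ind X p * ind Y q * ind D q * (if TotDist p q = true then (1:ℤ) else 0)) =
      ∑ p, ∑ q, ind X p * ind D q * ind Y q * (if TotDist p q = true then (1:ℤ) else 0) :=
    fun X Y => Finset.sum_congr rfl fun p _ => Finset.sum_congr rfl fun q _ => by ring
  have r11 := reord P1 Q1; have r01 := reord P0 Q1; have r22 := reord P2 Q2; have r02 := reord P0 Q2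
  have t11 := reord Q1 P1; have t01 := reord Q0 P1; have t22 := reord Q2 P2; have t02 := reord Q0 P2
  have F1 : 0 ≤ 2 ^ n * ((∑ p, ind D p * ind P1 p * ind Q1 p) + (∑ p, ind D p * ind P2 p * ind Q2 p)
      - (∑ p, ind D p * ind P1 p * ind Q2 p) - (∑ p, ind D p * ind P2 p * ind Q1 p)) := by
    refine mul_nonneg (pow_nonneg (by norm_num) n) ?_
    have e : ((∑ p, ind D p * ind P1 p * ind Q1 p) + (∑ p, ind D p * ind P2 p * ind Q2 p)
        - (∑ p, ind D p * ind P1 p * ind Q2 p) - (∑ p, ind D p * ind P2 p * ind Q1 p)) =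
        ∑ p, ind D p * ((ind P2 p - ind P1 p) * (ind Q2 p - ind Q1 p)) := by
      simp only [← Finset.sum_add_distrib, ← Finset.sum_sub_distrib]
      exact Finset.sum_congr rfl fun p _ => by ring
    rw [e]
    exact Finset.sum_nonneg fun p _ => mul_nonneg (ind_nonneg' D p) (mul_nonneg (by linarith [nP12 p]) (by linarith [nQ12 p]))
  have F3 : 0 ≤ (∑ q, ∑ r, ind P1 q * ind Q1 r * ind D (thirdPt q r) * (if TotDist q r = true then (1:ℤ) else 0))
      + (∑ q, ∑ r, ind P2 q * ind Q2 r * ind D (thirdPt q r) * (if TotDist q r = true then (1:ℤ) else 0))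
      - (∑ q, ∑ r, ind P1 q * ind Q2 r * ind D (thirdPt q r) * (if TotDist q r = true then (1:ℤ) else 0))
      - (∑ q, ∑ r, ind P2 q * ind Q1 r * ind D (thirdPt q r) * (if TotDist q r = true then (1:ℤ) else 0)) := by
    have e : (∑ q, ∑ r, ind P1 q * ind Q1 r * ind D (thirdPt q r) * (if TotDist q r = true then (1:ℤ) else 0))
        + (∑ q, ∑ r, ind P2 q * ind Q2 r * ind D (thirdPt q r) * (if TotDist q r = true then (1:ℤ) else 0))
        - (∑ q, ∑ r, ind P1 q * ind Q2 r * ind D (thirdPt q r) * (if TotDist q r = true then (1:ℤ) else 0))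
        - (∑ q, ∑ r, ind P2 q * ind Q1 r * ind D (thirdPt q r) * (if TotDist q r = true then (1:ℤ) else 0)) =
        ∑ q, ∑ r, (ind P2 q - ind P1 q) * (ind Q2 r - ind Q1 r) * (ind D (thirdPt q r) * (if TotDist q r = true then (1:ℤ) else 0)) := by
      simp only [← Finset.sum_add_distrib, ← Finset.sum_sub_distrib]
      exact Finset.sum_congr rfl fun q _ => Finset.sum_congr rfl fun r _ => by ring
    rw [e]
    refine Finset.sum_nonneg fun q _ => Finset.sum_nonneg fun r _ => ?_
    exact mul_nonneg (mul_nonneg (by linarith [nP12 q]) (by linarith [nQ12 r]))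
      (mul_nonneg (ind_nonneg' D _) (by split_ifs <;> norm_num))
  rw [eT11, eT12, eT21, eT22, eA, eHT, eHD]
  linarith [K1, K2, K3, K4, sw11, sw10, sw22, sw20, r11, r01, r22, r02, t11, t01, t22, t02, F1, F3]

/-! ### The top-only lift for `G` -/

/-- **TOP-ONLY LIFT, HARRIS-SHARPENED** (every `n`): if the up-set `A ⊆ [3]^{n+1}` meets only the top level of the last axis
(`A = D × {2}`), then for ARBITRARY up-sets `B, C ⊆ [3]^{n+1}`:  `2·G(D;B₂,C₂) ≤ G(A;B,C)`.  The difference is four fibre-Kleitman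
slacks plus `L(D;B₂∖B₀,C₂∖C₁) + L(D;B₂∖B₁,C₂∖C₀) ≥ 0`. [this work] -/
theorem topOnly_harris (A B C : Finset (Pd (n + 1)))
    (hA : IsUpperSet (A : Set (Pd (n + 1)))) (hB : IsUpperSet (B : Set (Pd (n + 1)))) (hC : IsUpperSet (C : Set (Pd (n + 1))))
    (hA0 : ∀ q : Pd n, (Fin.snoc q 0 : Pd (n + 1)) ∉ A) (hA1 : ∀ q : Pd n, (Fin.snoc q 1 : Pd (n + 1)) ∉ A) :
    2 * (sStarD (univ.filter fun q : Pd n => (Fin.snoc q 2 : Pd (n + 1)) ∈ A)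
          (univ.filter fun q : Pd n => (Fin.snoc q 2 : Pd (n + 1)) ∈ B)
          (univ.filter fun q : Pd n => (Fin.snoc q 2 : Pd (n + 1)) ∈ C)
        + (∑ p : Pd n, ∑ q : Pd n, ind (univ.filter fun q : Pd n => (Fin.snoc q 2 : Pd (n + 1)) ∈ A) p
            * ind (univ.filter fun q : Pd n => (Fin.snoc q 2 : Pd (n + 1)) ∈ B) q
            * ind (univ.filter fun q : Pd n => (Fin.snoc q 2 : Pd (n + 1)) ∈ C) q * (if TotDist p q = true then (1:ℤ) else 0))
        - 2 ^ n * (∑ p : Pd n, ind (univ.filter fun q : Pd n => (Fin.snoc q 2 : Pd (n + 1)) ∈ A) p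
            * ind (univ.filter fun q : Pd n => (Fin.snoc q 2 : Pd (n + 1)) ∈ B) p
            * ind (univ.filter fun q : Pd n => (Fin.snoc q 2 : Pd (n + 1)) ∈ C) p))
      ≤ sStarD A B C + (∑ x, ∑ y, ind A x * ind B y * ind C y * (if TotDist x y = true then (1:ℤ) else 0))
          - 2 * 2 ^ n * (∑ x, ind A x * ind B x * ind C x) := by
  set U : Finset (Pd n) := univ.filter fun q : Pd n => (Fin.snoc q 2 : Pd (n + 1)) ∈ A with hUdef
  set V : Finset (Pd n) := univ.filter fun q : Pd n => (Fin.snoc q 2 : Pd (n + 1)) ∈ B with hVdef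
  set W : Finset (Pd n) := univ.filter fun q : Pd n => (Fin.snoc q 2 : Pd (n + 1)) ∈ C with hWdef
  set v : Finset (Pd n) := univ.filter fun q : Pd n => (Fin.snoc q 1 : Pd (n + 1)) ∈ B with hvdef
  set w : Finset (Pd n) := univ.filter fun q : Pd n => (Fin.snoc q 1 : Pd (n + 1)) ∈ C with hwdef
  set b : Finset (Pd n) := univ.filter fun q : Pd n => (Fin.snoc q 0 : Pd (n + 1)) ∈ B with hbdef
  set c : Finset (Pd n) := univ.filter fun q : Pd n => (Fin.snoc q 0 : Pd (n + 1)) ∈ C with hcdef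
  have iU : ∀ p, ind A (Fin.snoc p 2) = ind U p := fun p => by rw [hUdef, ind_filter_snoc]
  have iV : ∀ p, ind B (Fin.snoc p 2) = ind V p := fun p => by rw [hVdef, ind_filter_snoc]
  have iW : ∀ p, ind C (Fin.snoc p 2) = ind W p := fun p => by rw [hWdef, ind_filter_snoc]
  have iv : ∀ p, ind B (Fin.snoc p 1) = ind v p := fun p => by rw [hvdef, ind_filter_snoc]
  have iw : ∀ p, ind C (Fin.snoc p 1) = ind w p := fun p => by rw [hwdef, ind_filter_snoc]
  have ib : ∀ p, ind B (Fin.snoc p 0) = ind b p := fun p => by rw [hbdef, ind_filter_snoc]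
  have ic : ∀ p, ind C (Fin.snoc p 0) = ind c p := fun p => by rw [hcdef, ind_filter_snoc]
  have iA0 : ∀ p, ind A (Fin.snoc p 0) = 0 := fun p => by unfold ind; rw [if_neg (hA0 p)]
  have iA1 : ∀ p, ind A (Fin.snoc p 1) = 0 := fun p => by unfold ind; rw [if_neg (hA1 p)]
  have hUup : IsUpperSet (U : Set (Pd n)) := by rw [hUdef]; exact isUpperSet_filter_snoc hA 2
  have hVup : IsUpperSet (V : Set (Pd n)) := by rw [hVdef]; exact isUpperSet_filter_snoc hB 2
  have hWup : IsUpperSet (W : Set (Pd n)) := by rw [hWdef]; exact isUpperSet_filter_snoc hC 2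
  have nbV : ∀ p, ind b p ≤ ind V p := fun p => by rw [← ib, ← iV]; exact ind_snoc_mono hB p (by decide)
  have nvV : ∀ p, ind v p ≤ ind V p := fun p => by rw [← iv, ← iV]; exact ind_snoc_mono hB p (by decide)
  have ncW : ∀ p, ind c p ≤ ind W p := fun p => by rw [← ic, ← iW]; exact ind_snoc_mono hC p (by decide)
  have nwW : ∀ p, ind w p ≤ ind W p := fun p => by rw [← iw, ← iW]; exact ind_snoc_mono hC p (by decide)
  have sbV : b ⊆ V := subset_of_ind_le nbV; have svV : v ⊆ V := subset_of_ind_le nvV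
  have scW : c ⊆ W := subset_of_ind_le ncW; have swW : w ⊆ W := subset_of_ind_le nwW
  -- the value of sStarD A B C (as in `two_mul_sStarD_top_le_of_topOnly`)
  have eA : sStarD A B C = 4 * 2 ^ n * (∑ p, ind U p * ind V p * ind W p)
      - (∑ p, ∑ q, ind U p * ind b q * ind c q * (if TotDist p q = true then (1:ℤ) else 0))
      - (∑ p, ∑ q, ind U p * ind v q * ind w q * (if TotDist p q = true then (1:ℤ) else 0))
      - (∑ p, ∑ q, ind b p * ind U q * ind W q * (if TotDist p q = true then (1:ℤ) else 0))
      - (∑ p, ∑ q, ind v p * ind U q * ind W q * (if TotDist p q = true then (1:ℤ) else 0))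
      - (∑ p, ∑ q, ind c p * ind U q * ind V q * (if TotDist p q = true then (1:ℤ) else 0))
      - (∑ p, ∑ q, ind w p * ind U q * ind V q * (if TotDist p q = true then (1:ℤ) else 0))
      + (∑ q, ∑ r, ind b q * ind w r * ind U (thirdPt q r) * (if TotDist q r = true then (1:ℤ) else 0))
      + (∑ q, ∑ r, ind v q * ind c r * ind U (thirdPt q r) * (if TotDist q r = true then (1:ℤ) else 0)) := by
    rw [sStarD_eq_sum_ind]
    simp only [sum_snoc, Fin.sum_univ_three, iA0, iA1, iU, iV, iW, iv, iw, ib, ic, zero_mul,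
      Finset.sum_const_zero, zero_add, Finset.sum_add_distrib]
    rw [block_eq, block_eq, block_eq, block_eq, block_eq, block_eq, block_eq, block_eq, block_eq]
    obtain ⟨a1, a2, a3, a4, a5, a6, a7, a8, a9, b1, b2, b3, b4, b5, b6, b7, b8, b9, d1, d2, d3, d4, d5, d6,
      f1, f2, f3, f4, f5, f6, f7, f8, f9⟩ := c_vals_top
    rw [a1, a2, a3, a4, a5, a6, a7, a8, a9, b1, b2, b3, b4, b5, b6, b7, b8, b9, d1, d2, d3, d4, d5, d6,
      f1, f2, f3, f4, f5, f6, f7, f8, f9]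
    ring
  obtain ⟨m00, m01, m02, m10, m11, m12, m20, m21, m22⟩ := ne_vals3
  have eHT : (∑ x, ∑ y, ind A x * ind B y * ind C y * (if TotDist x y = true then (1:ℤ) else 0)) =
      (∑ p, ∑ q, ind U p * ind b q * ind c q * (if TotDist p q = true then (1:ℤ) else 0))
      + (∑ p, ∑ q, ind U p * ind v q * ind w q * (if TotDist p q = true then (1:ℤ) else 0)) := by
    rw [td3_snoc]
    simp only [Fin.sum_univ_three, iA0, iA1, iU, iV, iW, iv, iw, ib, ic, zero_mul, Finset.sum_const_zero, mul_zero,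
      m00, m01, m02, m10, m11, m12, m20, m21, m22, one_mul, zero_add, add_zero]
  have eHD : (∑ x, ind A x * ind B x * ind C x) = (∑ p, ind U p * ind V p * ind W p) := by
    rw [diag3_snoc]
    simp only [Fin.sum_univ_three, iA0, iA1, iU, iV, iW, zero_mul, Finset.sum_const_zero, zero_add]
  have eT := sStarD_counting U V W
  have KB1 := sum_ind_lat_le_td (V \ b) hWup hUup; have KC1 := sum_ind_lat_le_td (W \ w) hVup hUup
  have KB2 := sum_ind_lat_le_td (V \ v) hWup hUup; have KC2 := sum_ind_lat_le_td (W \ c) hVup hUup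
  have eB1 : (∑ p, ∑ q, ind (V \ b) p * ind W q * ind U q * (if TotDist p q = true then (1:ℤ) else 0)) =
      (∑ p, ∑ q, ind V p * ind U q * ind W q * (if TotDist p q = true then (1:ℤ) else 0))
      - (∑ p, ∑ q, ind b p * ind U q * ind W q * (if TotDist p q = true then (1:ℤ) else 0)) := by
    rw [← Finset.sum_sub_distrib]; refine Finset.sum_congr rfl fun p _ => ?_
    rw [← Finset.sum_sub_distrib]; refine Finset.sum_congr rfl fun q _ => ?_
    rw [ind_sdiff_of_subset sbV]; ring
  have eB2 : (∑ p, ∑ q, ind (V \ v) p * ind W q * ind U q * (if TotDist p q = true then (1:ℤ) else 0)) =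
      (∑ p, ∑ q, ind V p * ind U q * ind W q * (if TotDist p q = true then (1:ℤ) else 0))
      - (∑ p, ∑ q, ind v p * ind U q * ind W q * (if TotDist p q = true then (1:ℤ) else 0)) := by
    rw [← Finset.sum_sub_distrib]; refine Finset.sum_congr rfl fun p _ => ?_
    rw [← Finset.sum_sub_distrib]; refine Finset.sum_congr rfl fun q _ => ?_
    rw [ind_sdiff_of_subset svV]; ring
  have eC1 : (∑ p, ∑ q, ind (W \ w) p * ind V q * ind U q * (if TotDist p q = true then (1:ℤ) else 0)) =
      (∑ p, ∑ q, ind W p * ind U q * ind V q * (if TotDist p q = true then (1:ℤ) else 0))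
      - (∑ p, ∑ q, ind w p * ind U q * ind V q * (if TotDist p q = true then (1:ℤ) else 0)) := by
    rw [← Finset.sum_sub_distrib]; refine Finset.sum_congr rfl fun p _ => ?_
    rw [← Finset.sum_sub_distrib]; refine Finset.sum_congr rfl fun q _ => ?_
    rw [ind_sdiff_of_subset swW]; ring
  have eC2 : (∑ p, ∑ q, ind (W \ c) p * ind V q * ind U q * (if TotDist p q = true then (1:ℤ) else 0)) =
      (∑ p, ∑ q, ind W p * ind U q * ind V q * (if TotDist p q = true then (1:ℤ) else 0))
      - (∑ p, ∑ q, ind c p * ind U q * ind V q * (if TotDist p q = true then (1:ℤ) else 0)) := by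
    rw [← Finset.sum_sub_distrib]; refine Finset.sum_congr rfl fun p _ => ?_
    rw [← Finset.sum_sub_distrib]; refine Finset.sum_congr rfl fun q _ => ?_
    rw [ind_sdiff_of_subset scW]; ring
  have lB1 : (∑ p, ∑ q, ind (V \ b) p * ind W q * ind U (thirdPt p q) * (if TotDist p q = true then (1:ℤ) else 0)) =
      (∑ p, ∑ q, ind V p * ind W q * ind U (thirdPt p q) * (if TotDist p q = true then (1:ℤ) else 0))
      - (∑ p, ∑ q, ind b p * ind W q * ind U (thirdPt p q) * (if TotDist p q = true then (1:ℤ) else 0)) := by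
    rw [← Finset.sum_sub_distrib]; refine Finset.sum_congr rfl fun p _ => ?_
    rw [← Finset.sum_sub_distrib]; refine Finset.sum_congr rfl fun q _ => ?_
    rw [ind_sdiff_of_subset sbV]; ring
  have lB2 : (∑ p, ∑ q, ind (V \ v) p * ind W q * ind U (thirdPt p q) * (if TotDist p q = true then (1:ℤ) else 0)) =
      (∑ p, ∑ q, ind V p * ind W q * ind U (thirdPt p q) * (if TotDist p q = true then (1:ℤ) else 0))
      - (∑ p, ∑ q, ind v p * ind W q * ind U (thirdPt p q) * (if TotDist p q = true then (1:ℤ) else 0)) := by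
    rw [← Finset.sum_sub_distrib]; refine Finset.sum_congr rfl fun p _ => ?_
    rw [← Finset.sum_sub_distrib]; refine Finset.sum_congr rfl fun q _ => ?_
    rw [ind_sdiff_of_subset svV]; ring
  have lC1 : (∑ p, ∑ q, ind (W \ w) p * ind V q * ind U (thirdPt p q) * (if TotDist p q = true then (1:ℤ) else 0)) =
      (∑ p, ∑ q, ind W p * ind V q * ind U (thirdPt p q) * (if TotDist p q = true then (1:ℤ) else 0))
      - (∑ p, ∑ q, ind w p * ind V q * ind U (thirdPt p q) * (if TotDist p q = true then (1:ℤ) else 0)) := by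
    rw [← Finset.sum_sub_distrib]; refine Finset.sum_congr rfl fun p _ => ?_
    rw [← Finset.sum_sub_distrib]; refine Finset.sum_congr rfl fun q _ => ?_
    rw [ind_sdiff_of_subset swW]; ring
  have lC2 : (∑ p, ∑ q, ind (W \ c) p * ind V q * ind U (thirdPt p q) * (if TotDist p q = true then (1:ℤ) else 0)) =
      (∑ p, ∑ q, ind W p * ind V q * ind U (thirdPt p q) * (if TotDist p q = true then (1:ℤ) else 0))
      - (∑ p, ∑ q, ind c p * ind V q * ind U (thirdPt p q) * (if TotDist p q = true then (1:ℤ) else 0)) := by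
    rw [← Finset.sum_sub_distrib]; refine Finset.sum_congr rfl fun p _ => ?_
    rw [← Finset.sum_sub_distrib]; refine Finset.sum_congr rfl fun q _ => ?_
    rw [ind_sdiff_of_subset scW]; ring
  rw [eB1, lB1] at KB1; rw [eB2, lB2] at KB2; rw [eC1, lC1] at KC1; rw [eC2, lC2] at KC2
  have swapL : ∀ X Y : Finset (Pd n),
      (∑ p, ∑ q, ind Y p * ind X q * ind U (thirdPt p q) * (if TotDist p q = true then (1:ℤ) else 0)) =
      ∑ q, ∑ r, ind X q * ind Y r * ind U (thirdPt q r) * (if TotDist q r = true then (1:ℤ) else 0) := by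
    intro X Y
    rw [Finset.sum_comm]
    refine Finset.sum_congr rfl fun q _ => Finset.sum_congr rfl fun r _ => ?_
    rw [thirdPt_comm r q, totDist_symm r q]; ring
  have sVW := swapL V W; have sVw := swapL V w; have sVc := swapL V c
  have F3a : 0 ≤ (∑ q, ∑ r, ind V q * ind W r * ind U (thirdPt q r) * (if TotDist q r = true then (1:ℤ) else 0))
      - (∑ q, ∑ r, ind b q * ind W r * ind U (thirdPt q r) * (if TotDist q r = true then (1:ℤ) else 0))
      - (∑ q, ∑ r, ind V q * ind w r * ind U (thirdPt q r) * (if TotDist q r = true then (1:ℤ) else 0))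
      + (∑ q, ∑ r, ind b q * ind w r * ind U (thirdPt q r) * (if TotDist q r = true then (1:ℤ) else 0)) := by
    have e : (∑ q, ∑ r, ind V q * ind W r * ind U (thirdPt q r) * (if TotDist q r = true then (1:ℤ) else 0))
        - (∑ q, ∑ r, ind b q * ind W r * ind U (thirdPt q r) * (if TotDist q r = true then (1:ℤ) else 0))
        - (∑ q, ∑ r, ind V q * ind w r * ind U (thirdPt q r) * (if TotDist q r = true then (1:ℤ) else 0))
        + (∑ q, ∑ r, ind b q * ind w r * ind U (thirdPt q r) * (if TotDist q r = true then (1:ℤ) else 0)) =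
        ∑ q, ∑ r, (ind V q - ind b q) * (ind W r - ind w r) * (ind U (thirdPt q r) * (if TotDist q r = true then (1:ℤ) else 0)) := by
      simp only [← Finset.sum_add_distrib, ← Finset.sum_sub_distrib]
      exact Finset.sum_congr rfl fun q _ => Finset.sum_congr rfl fun r _ => by ring
    rw [e]
    refine Finset.sum_nonneg fun q _ => Finset.sum_nonneg fun r _ => ?_
    exact mul_nonneg (mul_nonneg (by linarith [nbV q]) (by linarith [nwW r]))
      (mul_nonneg (ind_nonneg' U _) (by split_ifs <;> norm_num))
  have F3b : 0 ≤ (∑ q, ∑ r, ind V q * ind W r * ind U (thirdPt q r) * (if TotDist q r = true then (1:ℤ) else 0))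
      - (∑ q, ∑ r, ind v q * ind W r * ind U (thirdPt q r) * (if TotDist q r = true then (1:ℤ) else 0))
      - (∑ q, ∑ r, ind V q * ind c r * ind U (thirdPt q r) * (if TotDist q r = true then (1:ℤ) else 0))
      + (∑ q, ∑ r, ind v q * ind c r * ind U (thirdPt q r) * (if TotDist q r = true then (1:ℤ) else 0)) := by
    have e : (∑ q, ∑ r, ind V q * ind W r * ind U (thirdPt q r) * (if TotDist q r = true then (1:ℤ) else 0))
        - (∑ q, ∑ r, ind v q * ind W r * ind U (thirdPt q r) * (if TotDist q r = true then (1:ℤ) else 0))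
        - (∑ q, ∑ r, ind V q * ind c r * ind U (thirdPt q r) * (if TotDist q r = true then (1:ℤ) else 0))
        + (∑ q, ∑ r, ind v q * ind c r * ind U (thirdPt q r) * (if TotDist q r = true then (1:ℤ) else 0)) =
        ∑ q, ∑ r, (ind V q - ind v q) * (ind W r - ind c r) * (ind U (thirdPt q r) * (if TotDist q r = true then (1:ℤ) else 0)) := by
      simp only [← Finset.sum_add_distrib, ← Finset.sum_sub_distrib]
      exact Finset.sum_congr rfl fun q _ => Finset.sum_congr rfl fun r _ => by ring
    rw [e]
    refine Finset.sum_nonneg fun q _ => Finset.sum_nonneg fun r _ => ?_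
    exact mul_nonneg (mul_nonneg (by linarith [nvV q]) (by linarith [ncW r]))
      (mul_nonneg (ind_nonneg' U _) (by split_ifs <;> norm_num))
  rw [eT, eA, eHT, eHD]
  linarith [KB1, KB2, KC1, KC2, sVW, sVw, sVc, F3a, F3b]

end Summit.CriticalPhenomena.PercolationContinuityZ3.Theorems.SahiGridPattern
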